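import Summits.Schanuel.Schanuel.Theorems.DiophantineDichotomyApproximationPropertySliceTwo
import HarnessLib

/-!
# How much of crux `ApproximationProperty` the route needs LEVEL BY LEVEL, and its unconditional reach `n ≤ 3` (stmt-Schanuel-6117)

Route `DiophantineDichotomy` (sub-problem `Schanuel/Schanuel`), crux stmt-Schanuel-6117
`Summit.Schanuel.Schanuel.Theses.DiophantineDichotomy.ApproximationProperty` (Philippon's approximation
property in EVERY transcendence degree `t ≥ 1`; for `t ≥ 3` Philippon's open AP2/AP1 conjecture —
KERNEL-c5…c11 in `Cruxes/ApproximationProperty/`). Vocabulary: the line's definitions module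
`…ApproximationPropertyDefs.lean` (`PointwiseAPSlice t` = the crux at the fixed exponent `t`).

The route's deciding theorem `closes (hAP : ApproximationProperty) (hEv : KhovanskiiApproxTypeEv)
(hRed : KhovanskiiReduction) : Schanuel` applies `hAP` only at `θ = (s, e^s) ∈ ℂ^{2n}` with exponent
`t = n − 1` (race compactness at ONE scale `Δ` and ONE large `Y`). This file makes the LEVEL STRUCTURE
of that consumption a theorem (line lead `prover-line-stmt-Schanuel-6117-c11-0`, registered sub-goals of
the crux item, PROOFS ONLY — no definition, no named fact, no `sorry`):

* `khovanskiiSchanuel_upTo_of_slices` — the slices `PointwiseAPSlice t` for `1 ≤ t ≤ T` and the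
  eventual measure `KhovanskiiApproxTypeEv` give the route's target statement `KhovanskiiSchanuel`
  (Schanuel at free Khovanskii points) for every `n ≤ T + 1`. Proof = `closes` / `schanuel_of_apRace`
  verbatim (Hermite–Lindemann for `n ≤ 1`; race compactness for `n ≥ 2`) with `hAP` replaced by the
  slice at `t = n − 1 ≤ T`.
* `khovanskiiSchanuel_le_three` — UNCONDITIONALLY IN CRUX 3: `KhovanskiiApproxTypeEv →` the target for
  all `n ≤ 3`, because the slices `t = 1, 2` are LANDED theorems of the line
  (`slice_one`, `slice_two`: Laurent–Roy / Philippon's AP for `trdeg ≤ 2`, kernel-checked from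
  Nesterenko's elimination theory). So crux 3 is DISCHARGED for the route up to `n = 3`; the first level
  at which the route consumes OPEN content of crux 3 is `n = 4` (`t = 3`, Philippon's AP2 at `n = 3`).
* `khovanskiiSchanuel_le_four_of_slice_three` — the `t = 3` slice (conditional in the tree on the far
  deficient satellite kernel alone: `slice_three_of_farDef`, p140489) is exactly what level `n = 4` needs.

Sources: the route file (`closes`, planner 2026-08-16); `…ApproximationPropertyRace.lean` (c10);
NesterenkoPhilippon2001 (LNM 1752) Ch. 4 §4 p. 61; LaurentRoy1999; Philippon, JNT 81 (2000).
-/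

noncomputable section

-- `Summit.Schanuel.Schanuel.…` is the mandated summit/sub-problem namespace (single-conjunct summit), hence:
set_option linter.dupNamespace false

namespace Summit.Schanuel.Schanuel.Cruxes.ApproximationProperty.Race

open Summit.Schanuel.Schanuel.Theses.DiophantineDichotomy
open Summit.Schanuel.Schanuel.Cruxes.ApproximationProperty.OrbitInterpolationDeterminant
  (PointwiseAPSlice slice_one slice_two)

/-- **Registered sub-goal `khovanskiiSchanuel_upTo_of_slices`** — the LEVEL STRUCTURE of the route's
consumption of crux 3: if the approximation property holds at every exponent `1 ≤ t ≤ T`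
(`PointwiseAPSlice t`) and the eventual simultaneous-approximation measure `KhovanskiiApproxTypeEv`
holds, then every `ℚ`-linearly independent non-degenerate solution `s ∈ ℂⁿ` of a Khovanskii system with
`n ≤ T + 1` has `trdeg_ℚ ℚ(s, e^s) ≥ n`. Proof = the route's `closes` (equivalently c10's
`schanuel_of_apRace`) with `hAP` replaced by the slice at `t = n − 1`: `n = 0` trivial, `n = 1`
Hermite–Lindemann (`transcendental_exp_holds`), `n ≥ 2` race compactness — fix ONE scale
`Δ = max(Δ₀, c)` with `cC·c^{tA} ≤ Δ^{1−tA}`, take ONE `Y` beyond `Δ`, the race threshold and the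
Northcott separation of the finite set of points with coordinates of degree `≤ ⌊(cΔ)^t⌋` and height
`≤ max H₀(d)` (which misses `θ = (s, e^s)` by Hermite–Lindemann); the datum then has large height, the
eventual measure applies, and `Δ log H + dY ≤ cC(dᵃ log H + dᵇ)` contradicts `cC dᵃ ≤ Δ`,
`cC dᵇ < Y ≤ dY`. The slice's height budget is discarded. [folklore] -/
theorem khovanskiiSchanuel_upTo_of_slices :
    ∀ T : ℕ, (∀ t : ℕ, 1 ≤ t → t ≤ T → PointwiseAPSlice t) → KhovanskiiApproxTypeEv →
    ∀ (n : ℕ) (s : Fin n → ℂ), n ≤ T + 1 → LinearIndependent ℚ s →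
      (∃ g : Fin n → MvPolynomial (Fin n ⊕ Fin n) ℚ, (∀ i, MvPolynomial.aeval (Sum.elim s (Complex.exp ∘ s)) (g i) = 0) ∧ (Matrix.of fun i j => MvPolynomial.aeval (Sum.elim s (Complex.exp ∘ s)) (MvPolynomial.pderiv (Sum.inl j) (g i) + MvPolynomial.X (Sum.inr j) * MvPolynomial.pderiv (Sum.inr j) (g i))).det ≠ 0) →
      (n : Cardinal) ≤ Algebra.trdeg ℚ
        ↥(IntermediateField.adjoin ℚ (Set.range s ∪ Set.range (Complex.exp ∘ s))) := by
  intro T hS hEv n s hnT hs hg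
  have HL := @Literature.NumberTheory.Transcendental.transcendental_exp_holds
  have one_le_of_transc : ∀ {L : IntermediateField ℚ ℂ} {w : ℂ}, w ∈ L → Transcendental ℚ w →
      (1 : Cardinal) ≤ Algebra.trdeg ℚ L := by
    intro L w hw ht
    haveI : Algebra.Transcendental ℚ L :=
      ⟨⟨⟨w, hw⟩, fun h => ht (IntermediateField.isAlgebraic_iff.mp h)⟩⟩
    exact Cardinal.one_le_iff_pos.mpr (_root_.trdeg_pos ℚ L)
  have one_le_of_root : ∀ {P : Polynomial ℤ} {d : ℕ} {z : ℂ}, P ≠ 0 → P.natDegree ≤ d →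
      Polynomial.aeval z P = 0 → 1 ≤ d := by
    intro P d z hP hdeg hz
    by_contra hd
    have hd0 : P.natDegree = 0 := by omega
    rw [Polynomial.eq_C_of_natDegree_eq_zero hd0, Polynomial.aeval_C, eq_intCast,
      Int.cast_eq_zero] at hz
    apply hP
    rw [Polynomial.eq_C_of_natDegree_eq_zero hd0, hz, map_zero]
  have algQ : ∀ {z : ℂ} {P : Polynomial ℤ}, P ≠ 0 → Polynomial.aeval z P = 0 → IsAlgebraic ℚ z :=
    fun hP hz => IsAlgebraic.extendScalars (R := ℤ) (S := ℚ) (algebraMap ℤ ℚ).injective_int ⟨_, hP, hz⟩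
  rcases Nat.lt_or_ge n 2 with hn | hn
  · interval_cases n
    · simp
    · -- `n = 1`: Hermite–Lindemann
      rw [Nat.cast_one]
      by_cases halg : IsAlgebraic ℚ (s 0)
      · exact one_le_of_transc (IntermediateField.subset_adjoin ℚ _ (Or.inr ⟨0, rfl⟩))
          (HL halg (hs.ne_zero 0))
      · exact one_le_of_transc (IntermediateField.subset_adjoin ℚ _ (Or.inl ⟨0, rfl⟩)) halg
  · -- `n ≥ 2`: the EVENTUAL exponent race (race compactness: fix `Δ`, let `Y → ∞`)
    by_contra hlt
    rw [not_le] at hlt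
    have key : ∀ S : Set ℂ, S = Set.range s ∪ Set.range (Complex.exp ∘ s) →
        Algebra.trdeg ℚ ↥(IntermediateField.adjoin ℚ S) ≤ ((n - 1 : ℕ) : Cardinal) := by
      rintro S rfl
      have h1 : (n : Cardinal) = Order.succ ((n - 1 : ℕ) : Cardinal) := by
        rw [Cardinal.succ_natCast]
        exact_mod_cast (by omega : n = n - 1 + 1)
      rw [h1] at hlt
      exact Order.lt_succ_iff.mp hlt
    -- the LANDED slice at `t = n - 1 ≤ T` supplies the approximation property AT `θ = (s, e^s)`
    obtain ⟨c, hc1, hAP'⟩ := hS (n - 1) (by omega) (by omega) (Fin n ⊕ Fin n)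
      (Sum.elim s (Complex.exp ∘ s)) (key _ (Set.Sum.elim_range _ _))
    obtain ⟨a, b, C, ha, hC, hEv'⟩ := hEv n s hn hs hg
    choose H₀ hH₀ using hEv'
    have hcpos : (0 : ℝ) < c := lt_of_lt_of_le one_pos hc1
    -- THE RACE (pure real analysis): a THRESHOLD for the scale `Δ`, then every large `Y`
    have race : ∀ t : ℕ, 1 ≤ t → a < 1 / (t : ℝ) → ∃ Δ₀ : ℝ, ∀ Δ : ℝ, Δ₀ ≤ Δ → c ≤ Δ →
        ∃ Y₁ : ℝ, 0 ≤ Y₁ ∧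
        ∀ Y : ℝ, Y₁ ≤ Y → ∀ d H : ℕ, 1 ≤ d → 1 ≤ H → (d : ℝ) ≤ (c * Δ) ^ t →
          c * (C * ((d : ℝ) ^ a * Real.log H + (d : ℝ) ^ b)) < Real.log H * Δ + d * Y := by
      intro t ht hat
      set A : ℝ := max a 0
      set B : ℝ := max b 0
      have htpos : (0 : ℝ) < t := by exact_mod_cast ht
      have hA0 : 0 ≤ A := le_max_right _ _
      have hB0 : 0 ≤ B := le_max_right _ _
      have hAt : (t : ℝ) * A < 1 := by
        have hA' : A < 1 / (t : ℝ) := max_lt hat (by positivity)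
        calc (t : ℝ) * A < t * (1 / t) := mul_lt_mul_of_pos_left hA' htpos
          _ = 1 := mul_one_div_cancel htpos.ne'
      set e : ℝ := 1 - t * A with he
      have hepos : 0 < e := by rw [he]; linarith
      set M : ℝ := c * C * c ^ ((t : ℝ) * A) with hM
      have hev : ∀ᶠ Δ in Filter.atTop, M ≤ Δ ^ e :=
        (tendsto_rpow_atTop hepos).eventually_ge_atTop M
      obtain ⟨Δ₀, hΔ₀⟩ := Filter.eventually_atTop.mp hev
      refine ⟨Δ₀, fun Δ hΔ₀Δ hcΔ => ?_⟩
      have hMΔ : M ≤ Δ ^ e := hΔ₀ Δ hΔ₀Δ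
      have hΔpos : 0 < Δ := lt_of_lt_of_le hcpos hcΔ
      have hcΔpos : 0 < c * Δ := mul_pos hcpos hΔpos
      have hcC : 0 ≤ c * C := by positivity
      refine ⟨c * C * (c * Δ) ^ ((t : ℝ) * B) + 1, by positivity,
        fun Y hY₁Y d H hd hH hdle => ?_⟩
      have hd1 : (1 : ℝ) ≤ d := by exact_mod_cast hd
      have hd0 : (0 : ℝ) ≤ d := by positivity
      have hL : 0 ≤ Real.log H := Real.log_nonneg (by exact_mod_cast hH)
      have hda : (d : ℝ) ^ a ≤ (d : ℝ) ^ A :=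
        Real.rpow_le_rpow_of_exponent_le hd1 (le_max_left _ _)
      have hdb : (d : ℝ) ^ b ≤ (d : ℝ) ^ B :=
        Real.rpow_le_rpow_of_exponent_le hd1 (le_max_left _ _)
      have hpow : ∀ E : ℝ, 0 ≤ E → (d : ℝ) ^ E ≤ (c * Δ) ^ ((t : ℝ) * E) := fun E hE => by
        calc (d : ℝ) ^ E ≤ ((c * Δ) ^ t) ^ E := Real.rpow_le_rpow hd0 hdle hE
          _ = (c * Δ) ^ ((t : ℝ) * E) := by
            rw [← Real.rpow_natCast, ← Real.rpow_mul hcΔpos.le]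
      have hI : c * C * (d : ℝ) ^ A ≤ Δ := by
        calc c * C * (d : ℝ) ^ A ≤ c * C * (c * Δ) ^ ((t : ℝ) * A) :=
              mul_le_mul_of_nonneg_left (hpow A hA0) hcC
          _ = M * Δ ^ ((t : ℝ) * A) := by
              rw [Real.mul_rpow hcpos.le hΔpos.le, hM]; ring
          _ ≤ Δ ^ e * Δ ^ ((t : ℝ) * A) :=
              mul_le_mul_of_nonneg_right hMΔ (Real.rpow_nonneg hΔpos.le _)
          _ = Δ := by
              rw [← Real.rpow_add hΔpos, he, sub_add_cancel, Real.rpow_one]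
      have hI' : c * C * (d : ℝ) ^ A * Real.log H ≤ Δ * Real.log H :=
        mul_le_mul_of_nonneg_right hI hL
      have hY0 : 0 ≤ Y := le_trans (by positivity) hY₁Y
      have hII : c * C * (d : ℝ) ^ B < (d : ℝ) * Y := by
        calc c * C * (d : ℝ) ^ B ≤ c * C * (c * Δ) ^ ((t : ℝ) * B) :=
              mul_le_mul_of_nonneg_left (hpow B hB0) hcC
          _ < c * C * (c * Δ) ^ ((t : ℝ) * B) + 1 := lt_add_one _
          _ ≤ Y := hY₁Y
          _ ≤ (d : ℝ) * Y := le_mul_of_one_le_left hY0 hd1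
      have h1 : c * C * ((d : ℝ) ^ a * Real.log H) ≤ c * C * ((d : ℝ) ^ A * Real.log H) :=
        mul_le_mul_of_nonneg_left (mul_le_mul_of_nonneg_right hda hL) hcC
      have h2 : c * C * (d : ℝ) ^ b ≤ c * C * (d : ℝ) ^ B := mul_le_mul_of_nonneg_left hdb hcC
      have hexp : c * (C * ((d : ℝ) ^ a * Real.log H + (d : ℝ) ^ b)) =
          c * C * ((d : ℝ) ^ a * Real.log H) + c * C * (d : ℝ) ^ b := by ring
      rw [hexp]
      linarith [h1, h2, hI', hII]
    have ha' : a < 1 / ((n - 1 : ℕ) : ℝ) := by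
      rw [Nat.cast_sub (by omega), Nat.cast_one]; exact ha
    obtain ⟨Δ₀, hrace₀⟩ := race (n - 1) (by omega) ha'
    -- ONE scale `Δ := max Δ₀ c`
    set Δ : ℝ := max Δ₀ c with hΔdef
    have hΔ₀Δ : Δ₀ ≤ Δ := le_max_left _ _
    have hcΔ : c ≤ Δ := le_max_right _ _
    obtain ⟨Y₁, hY₁0, hrace⟩ := hrace₀ Δ hΔ₀Δ hcΔ
    have hΔpos : 0 < Δ := lt_of_lt_of_le hcpos hcΔ
    -- RACE COMPACTNESS: the degree cap `D₀` and the uniform height threshold `H⋆`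
    obtain ⟨D₀, hD₀⟩ : ∃ D₀ : ℕ, ∀ d : ℕ, (d : ℝ) ≤ (c * Δ) ^ (n - 1) → d ≤ D₀ :=
      ⟨⌊(c * Δ) ^ (n - 1)⌋₊, fun d hd => Nat.le_floor hd⟩
    obtain ⟨Hstar, hHstar⟩ : ∃ Hstar : ℕ, ∀ d : ℕ, d ≤ D₀ → H₀ d ≤ Hstar :=
      ⟨(Finset.range (D₀ + 1)).sup H₀, fun d hd =>
        Finset.le_sup (f := H₀) (Finset.mem_range.mpr (Nat.lt_succ_of_le hd))⟩
    obtain ⟨E, hE⟩ : ∃ E : Set (Fin n ⊕ Fin n → ℂ), ∀ γ, γ ∈ E ↔ ∀ i, ∃ P : Polynomial ℤ, P ≠ 0 ∧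
        P.natDegree ≤ D₀ ∧ (∀ k, |P.coeff k| ≤ (Hstar : ℤ)) ∧ Polynomial.aeval (γ i) P = 0 :=
      ⟨{γ | ∀ i, ∃ P : Polynomial ℤ, P ≠ 0 ∧ P.natDegree ≤ D₀ ∧ (∀ k, |P.coeff k| ≤ (Hstar : ℤ)) ∧
          Polynomial.aeval (γ i) P = 0}, fun γ => Iff.rfl⟩
    have hinj : Function.Injective (algebraMap ℤ ℂ) := (algebraMap ℤ ℂ).injective_int
    have hEfin : E.Finite := by
      have hR := Polynomial.bUnion_roots_finite (algebraMap ℤ ℂ) D₀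
        (Set.finite_Icc (-(Hstar : ℤ)) (Hstar : ℤ))
      refine (Set.Finite.pi fun (_ : Fin n ⊕ Fin n) => hR).subset fun γ hγ => ?_
      rw [Set.mem_univ_pi]
      intro i
      obtain ⟨P, hP0, hdeg, hcoef, hroot⟩ := (hE γ).mp hγ i
      refine Set.mem_iUnion₂.mpr ⟨P, ⟨hdeg, fun k => Set.mem_Icc.mpr (abs_le.mp (hcoef k))⟩, ?_⟩
      rw [Finset.mem_coe, Multiset.mem_toFinset, Polynomial.mem_roots_map_of_injective hinj hP0,
        ← Polynomial.aeval_def]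
      exact hroot
    have hθE : Sum.elim s (Complex.exp ∘ s) ∉ E := by
      intro hθ
      obtain ⟨P, hP0, -, -, hPz⟩ := (hE _).mp hθ (Sum.inl ⟨0, by omega⟩)
      obtain ⟨Q, hQ0, -, -, hQz⟩ := (hE _).mp hθ (Sum.inr ⟨0, by omega⟩)
      exact HL (algQ hP0 hPz) (hs.ne_zero _) (algQ hQ0 hQz)
    have htend : Filter.Tendsto (fun Y : ℝ => Real.exp (-(Y / c))) Filter.atTop (nhds 0) :=
      Real.tendsto_exp_atBot.comp
        (Filter.tendsto_neg_atTop_atBot.comp (Filter.tendsto_id.atTop_div_const hcpos))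
    have hall : ∀ᶠ Y : ℝ in Filter.atTop, ∀ p ∈ E,
        Real.exp (-(Y / c)) < ‖p - Sum.elim s (Complex.exp ∘ s)‖ := by
      refine (hEfin.eventually_all).mpr fun p hp => htend.eventually (gt_mem_nhds ?_)
      rw [norm_pos_iff, sub_ne_zero]
      rintro rfl
      exact hθE hp
    -- a THRESHOLD `Y₂` for all three eventual conditions, then ONE height `Y := max Y₂ Δ`
    obtain ⟨Y₂, hY₂⟩ := Filter.eventually_atTop.mp
      ((Filter.eventually_ge_atTop Δ).and ((Filter.eventually_ge_atTop Y₁).and hall))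
    set Y : ℝ := max Y₂ Δ with hYdef
    have hY₂Y : Y₂ ≤ Y := le_max_left _ _
    -- the datum of the slice at `(Δ, Y)`; its height budget `log H ≤ c Y Δ^{t-1}` is DISCARDED
    obtain ⟨γ, d, H, hfin, hpoly, hdcap, -, hdist⟩ := hAP' Δ Y hcΔ (le_max_right _ _)
    obtain ⟨-, hY₁Y, hYsep⟩ := hY₂ Y hY₂Y
    obtain ⟨P₀, hP₀0, hP₀deg, -, hP₀z⟩ := hpoly (Sum.inl ⟨0, by omega⟩)
    have h1d : 1 ≤ d := one_le_of_root hP₀0 hP₀deg hP₀z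
    have hY0 : 0 ≤ Y := le_trans hY₁0 hY₁Y
    have hdistY : ‖γ - Sum.elim s (Complex.exp ∘ s)‖ ≤ Real.exp (-(Y / c)) := by
      refine hdist.trans (Real.exp_le_exp.mpr ?_)
      have hlogH : 0 ≤ Real.log H := Real.log_natCast_nonneg H
      have hYle : Y ≤ Real.log H * Δ + d * Y := by
        have hdY : Y ≤ (d : ℝ) * Y := le_mul_of_one_le_left hY0 (by exact_mod_cast h1d)
        nlinarith [mul_nonneg hlogH hΔpos.le]
      have := div_le_div_of_nonneg_right hYle hcpos.le
      linarith
    have hγE : γ ∉ E := fun hγ => absurd hdistY (not_le.mpr (hYsep γ hγ))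
    have hHstar_lt : Hstar < H := by
      by_contra hH
      push Not at hH
      refine hγE ((hE γ).mpr fun i => ?_)
      obtain ⟨P, hP0, hPdeg, hPH, hPz⟩ := hpoly i
      exact ⟨P, hP0, hPdeg.trans (hD₀ d hdcap), fun k => (hPH k).trans (by exact_mod_cast hH), hPz⟩
    have hlow := hH₀ d H γ ((hHstar d (hD₀ d hdcap)).trans hHstar_lt.le) hfin hpoly
    have h1H : 1 ≤ H := Nat.succ_le_of_lt (lt_of_le_of_lt (Nat.zero_le _) hHstar_lt)
    have hsand := neg_le_neg (Real.exp_le_exp.mp (hlow.trans hdist))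
    rw [neg_neg, neg_neg, div_le_iff₀ hcpos] at hsand
    have hwin := hrace Y hY₁Y d H h1d h1H hdcap
    linarith

/-- **Registered sub-goal `khovanskiiSchanuel_le_three`** — CRUX 3 IS DISCHARGED FOR THE ROUTE UP TO
`n = 3`: from the eventual measure `KhovanskiiApproxTypeEv` (crux 2) ALONE, every `ℚ`-linearly
independent non-degenerate solution `s ∈ ℂⁿ` of a Khovanskii system with `n ≤ 3` has
`trdeg_ℚ ℚ(s, e^s) ≥ n` — the approximation-property input at `t = n − 1 ≤ 2` being the LANDED slices
`slice_one`, `slice_two` (Philippon's AP for `trdeg ≤ 2`, kernel-checked, no named fact). The first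
level at which the route needs OPEN content of crux 3 (Philippon's AP2 at `n = 3`) is `n = 4`.
[cite: NesterenkoPhilippon2001, Ch. 4 §4 (p. 61)] -/
theorem khovanskiiSchanuel_le_three :
    KhovanskiiApproxTypeEv → ∀ (n : ℕ) (s : Fin n → ℂ), n ≤ 3 → LinearIndependent ℚ s →
      (∃ g : Fin n → MvPolynomial (Fin n ⊕ Fin n) ℚ, (∀ i, MvPolynomial.aeval (Sum.elim s (Complex.exp ∘ s)) (g i) = 0) ∧ (Matrix.of fun i j => MvPolynomial.aeval (Sum.elim s (Complex.exp ∘ s)) (MvPolynomial.pderiv (Sum.inl j) (g i) + MvPolynomial.X (Sum.inr j) * MvPolynomial.pderiv (Sum.inr j) (g i))).det ≠ 0) →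
      (n : Cardinal) ≤ Algebra.trdeg ℚ
        ↥(IntermediateField.adjoin ℚ (Set.range s ∪ Set.range (Complex.exp ∘ s))) :=
  khovanskiiSchanuel_upTo_of_slices 2 fun t h1 h2 => by
    rcases Nat.lt_or_ge t 2 with h | h
    · obtain rfl : t = 1 := by omega
      exact slice_one
    · obtain rfl : t = 2 := le_antisymm h2 h
      exact slice_two

/-- **Registered sub-goal `khovanskiiSchanuel_le_four_of_slice_three`** — what the `t = 3` slice buys:
with `PointwiseAPSlice 3` (in the tree CONDITIONAL on the far deficient satellite kernel alone,
`slice_three_of_farDef`, p140489 — the open residual of Philippon's AP2 at `n = 3`) the route's target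
holds for all `n ≤ 4`. [cite: NesterenkoPhilippon2001, Ch. 4 §4 (p. 61)] -/
theorem khovanskiiSchanuel_le_four_of_slice_three :
    PointwiseAPSlice 3 → KhovanskiiApproxTypeEv →
    ∀ (n : ℕ) (s : Fin n → ℂ), n ≤ 4 → LinearIndependent ℚ s →
      (∃ g : Fin n → MvPolynomial (Fin n ⊕ Fin n) ℚ, (∀ i, MvPolynomial.aeval (Sum.elim s (Complex.exp ∘ s)) (g i) = 0) ∧ (Matrix.of fun i j => MvPolynomial.aeval (Sum.elim s (Complex.exp ∘ s)) (MvPolynomial.pderiv (Sum.inl j) (g i) + MvPolynomial.X (Sum.inr j) * MvPolynomial.pderiv (Sum.inr j) (g i))).det ≠ 0) →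
      (n : Cardinal) ≤ Algebra.trdeg ℚ
        ↥(IntermediateField.adjoin ℚ (Set.range s ∪ Set.range (Complex.exp ∘ s))) :=
  fun h3 => khovanskiiSchanuel_upTo_of_slices 3 fun t h1 h3t => by
    rcases Nat.lt_or_ge t 2 with h | h
    · obtain rfl : t = 1 := by omega
      exact slice_one
    · rcases Nat.lt_or_ge t 3 with h' | h'
      · obtain rfl : t = 2 := by omega
        exact slice_two
      · obtain rfl : t = 3 := le_antisymm h3t h'
        exact h3

end Summit.Schanuel.Schanuel.Cruxes.ApproximationProperty.Race

end
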